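import Summits.ABC.IUTFork.Conditional.AbcOfSGenuine
import Summits.ABC.IUTFork.Conditional.AbcOfSShrink2
import Summits.ABC.ABC.Theorems.IUTThetaPilotThetaPartIIStubThetaData
import Literature.IUT.LogVolume.Corollary22Thm110LegendreWitness
import HarnessLib

/-!
# The `q`-idele binder of the branch-C certificates is UNSATISFIABLE at the pilot data of initial Θ-data:
# `abc_of_S_v3`'s hypothesis `H` is FALSE, `abc_of_S_shrink2`/`shrink3`'s side conditions `hX ∧ htq` are contradictory

PROOF-ONLY file (0 `def`, no new `Prop`) of the abc-iut cell, seat abc-iut-w5-d054 (gen 4; S-lane number theory), written as a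
VACUITY AUDIT (cell rule «vacuity-audit every fork-level hypothesis», LANA Rem. 8.2.1 discipline; ADJUDICATION-SPEC §4) of the
branch-C certificate family at the GENUINE setting — abc-iut-C-cert-2's `abc_of_S_v3` / `cor312Of_of_S(H)_genuine` (p430884),
abc-iut-C-cert-3's `Shrink2.cor312Of_of_S` / `abc_of_S_shrink2` (p430322) and `abc_of_SH_shrink3`. TAKES NO SIDE on [IUTchIII]
Cor. 3.12; refutes neither S nor S_H; nothing here bears on `−|log(Θ)|` versus `−|log(q)|`.

THE POINT. All these certificates read the pilot regions of abc-iut-c312-7's print-normalised real setting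
`Thm311.Real.settingPrVolSharp X … tq t …` off ideles over the completions `F_v` of the field `F` of the pilot data
`X : PilotData F`, and carry the side condition `htq`: the `q`-ideles REALISE the `q`-pilot divisor in Dupuy–Hilado's
normalisation (3.4), `log ‖t_{q,v}‖ = −P_q(v)·ln|κ(v)|/n_v`, `P_q(v) = ord_v(q_v)/(2l)` (DH §3.3, c312-3's `PilotData.qPilot`).
abc-iut-c312-3 proved such ideles EXIST when `2l ∣ ord_v(q_v)` on `S` (`exists_realising_qIdeles`, p420764), and the certificate
docstrings record «`htq` iff `2l ∣ ord_v(q_v)` … a RECORDED SEAM … a genuine restriction on `D`». This file proves: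
* `Thm311.Real.two_mul_l_dvd_ordq_of_realising` — the CONVERSE: realising `q`-ideles force `2l ∣ ord_v(q_v)` at every `v ∈ S`
  (the norm group of `F_v^×` is `p^{(1/e)ℤ}`: abc-iut-S7's `exists_isUniformizer_rescaledCompletion`; `Real.log ‖0‖ = 0` excludes
  `t_{q,v} = 0` since `P_q(v) > 0`), whence `exists_realising_qIdeles_iff`;
* `Cor312Prov.not_two_mul_l_dvd_ordq_of_isPilotDataOf` — at the pilot data OF initial Θ-data (abc-iut-c312-8's
  `IsPilotDataOf D X`: `S = 𝕍(F)^bad`, `ord_v(q_v) = ord_v(Δ_min)`, same `l`) the typed [IUTchI] Def. 3.1 (c) clause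
  `InitialThetaData.l_coprime_qParamOrd` («`l` prime to the orders of the `q`-parameters», kurims p. 62) gives
  `l ∤ ord_v(q_v)`, so `2l ∤ ord_v(q_v)` at EVERY `v ∈ S ≠ ∅` — it is not a «restriction on `D`», it fails for ALL `D`;
* hence `Cor312Prov.false_of_isPilotDataOf_of_realising` / `not_exists_realising_qIdeles_of_isPilotDataOf` /
  `not_hdiv_of_isPilotDataOf`: NO `q`-ideles over the `F_v` realise `P_q` at the `X` of a `D`; c312-7's non-vacuity theorem
  `exists_ideles_settingPrVolSharp` (hypothesis `hdiv`) inhabits the idele binders for SYNTHETIC pilot data only;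
* CONSEQUENCES for the certificates (§3): `Conditional.abc_of_S_v3_hypothesis_false` — the single bundled hypothesis `H` of
  the certificate of record `abc_of_S_v3` (text copied byte-for-byte from `AbcOfSGenuine.lean` l. 302–374) is FALSE, because an
  admissible `λ`-line datum exists to instantiate it (`exists_admissible_thetaVolumeDatum` = `Cor22.exists_thm110Legendre_antecedent`
  + the PROVED child (i) `ThetaPartII.stub_thetaData`); `abc_of_S_shrink2_side_conditions_false` — Shrink2's (= Shrink3's)
  binders `hX`, `htq` are jointly unsatisfiable; `cor312Of_of_isPilotDataOf_of_realising` — per datum, `hX ∧ htq` alone «prove»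
  `I.Cor312Of` for every `I` (ex falso), so every other binder of the per-datum certificates is idle next to them.
So `abc_of_S_v3 : H → hvol → ABC`, `abc_of_S_shrink2` and `abc_of_SH_shrink3` are VACUOUS (false antecedents); the C-scoreboard
movement «`hq` DISCHARGED at the genuine setting» (Shrink2) rests on a contradictory side condition. Hypothesis-CENSUS tools
(binder counts, idle-hypothesis probes) cannot see this: the binders are all USED — they are inconsistent.

ROOT CAUSE AND REPAIR (for the owners c312-7 / c312-8 / C-cert; nothing filed here changes their files). Print realises the
`q`-pilot as `q̲_v = q_v^{1/2l} ∈ K_v̲`, `K = F(E_F[l]) ⊋ F` ([IUTchI] Ex. 3.2 (iv), kurims p. 71; Def. 3.1 (e): the local data at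
`v̲ ∈ V̲ ⊆ V(K)`), where `ord_v̲(q_v) = e(v̲|v)·ord_v(q_v)` IS divisible by `2l`; over `F_v` itself `ord_v(q_v)/(2l) ∉ ℤ` by Def. 3.1
(c). Two honest repairs: (R1) realise the INTEGRAL divisor `𝔮 = 2l·P_q` (`t_{q,v} := q_v ∈ F_v`) and carry the factor `1/(2l)` in
the volume normalisation of `negLogQ`; (R2) type the pilot ideles (and `kOf`) over the completions `K_v̲` of the section `V̲`, with
the provenance `IsPilotDataOf` taken over `K`. Until then every «discharged at the genuine setting with realising q-ideles» line
of the C family is vacuous at pilot data of initial Θ-data, and should be reported so at 11:30Z/12:30Z.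
[cite: Mochizuki2012, IUTchI Def. 3.1 (c) p. 62; Ex. 3.2 (iv) p. 71] [cite: DupuyHilado2025, §3.3, §3.4]
[cite: NeukirchANT1999, Ch. II Prop. (6.8)] [claim: Mochizuki2012, status: disputed] for every IUT quotation.
HONEST FRAMING: statements about OUR typed objects; typed ≠ proved; nothing here asserts or denies abc or Cor. 3.12.
-/

noncomputable section

open Set Function NumberField IsDedekindDomain

namespace Summit.ABC.IUTFork

namespace Thm311.Real

open Cor312 Cor312Vol Literature.IUT.LogThetaLattice Literature.IUT.LogVolume Literature.NumberTheory.NumberFields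
  Literature.NumberTheory.GaloisRepresentations.Ultrametric

variable {F : Type} [Field F] [NumberField F] (X : PilotData F)

/-- **Value group of the rescaled completion at a fibre point.** Every non-zero element `a` of the local field
`K_v = kOf X p x` (abc-iut-S7's `RescaledCompletion F p v`, normed by `‖·‖_v^{1/n_v}`) has
`log ‖a‖ = −(k/e(v|p))·log p` for some INTEGER `k` (powers of a norm uniformizer,
`exists_isUniformizer_rescaledCompletion`). [cite: NeukirchANT1999, Ch. II Prop. (6.8)] -/
theorem exists_int_log_norm_kOf_eq (p : ℕ) [Fact p.Prime] (x : (thetaIndex X).Fibre (.inr (ratPrime p)))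
    {a : kOf X p x} (ha : a ≠ 0) :
    ∃ k : ℤ, Real.log ‖a‖ =
      -(k : ℝ) / ((placeOf X p x).asIdeal.ramificationIdx ℤ : ℝ) * Real.log p := by
  obtain ⟨ϖ, hϖ, hnorm⟩ :=
    exists_isUniformizer_rescaledCompletion F p (placeOf X p x) (natCast_mem_placeOf X p x)
  obtain ⟨k, hk⟩ := hϖ.2 (Units.mk0 a ha)
  refine ⟨k, ?_⟩
  have hp : (0 : ℝ) < p := by exact_mod_cast (Fact.out : p.Prime).pos
  rw [show ‖a‖ = ‖((Units.mk0 a ha : (kOf X p x)ˣ) : kOf X p x)‖ from rfl, hk, hnorm,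
    ← Real.rpow_intCast, ← Real.rpow_mul hp.le, Real.log_rpow hp]
  ring

/-- **Realising `q`-ideles force `2l ∣ ord_v(q_v)` on `S`** — the CONVERSE of abc-iut-c312-3's
`exists_realising_qIdeles` (p420764): if a family of `q`-ideles `t_{q,v} ∈ F_v` satisfies Dupuy–Hilado's
normalisation (3.4) `log ‖t_{q,v}‖ = −P_q(v)·ln|κ(v)|/n_v` with `P_q(v) = ord_v(q_v)/(2l)` (DH §3.3), then
`ord_v(q_v)/(2l)` is the valuation of an element of `F_v^×`, i.e. an INTEGER, at every `v ∈ S` (at `t_{q,v} = 0`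
Mathlib's `Real.log ‖0‖ = 0` contradicts `P_q(v) > 0`). [cite: DupuyHilado2025, §3.3, §3.4] -/
theorem two_mul_l_dvd_ordq_of_realising
    (tq : ∀ (pp : Nat.Primes) (x : (thetaIndex X).Fibre (.inr pp)), haveI : Fact (pp : ℕ).Prime := ⟨pp.2⟩; kOf X pp.1 x)
    (htq : ∀ (pp : Nat.Primes) (x : (thetaIndex X).Fibre (.inr pp)),
      haveI : Fact (pp : ℕ).Prime := ⟨pp.2⟩
      Real.log ‖tq pp x‖ = -(X.qPilot (placeOf X pp.1 x)) * logNorm F (placeOf X pp.1 x) /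
        localDegree F (placeOf X pp.1 x))
    {v : HeightOneSpectrum (𝓞 F)} (hv : v ∈ X.S) : (2 * X.l : ℤ) ∣ X.ordq v := by
  -- the rational prime under `v` and the fibre point of `V(F) → V_ℚ` above it that IS `v`
  obtain ⟨pp, hpp⟩ : ∃ pp : Nat.Primes, residueChar F v = (pp : ℕ) :=
    ⟨⟨residueChar F v, residueChar_prime F v⟩, rfl⟩
  haveI : Fact (pp : ℕ).Prime := ⟨pp.2⟩
  have hvp : v ∈ placesOver F (pp : ℕ) := (mem_placesOver_iff_residueChar v).mpr hpp
  obtain ⟨x, hx⟩ : ∃ x : (thetaIndex X).Fibre (.inr pp), placeOf X (pp : ℕ) x = v :=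
    ⟨(fibreEquivPlacesOver X pp).symm ⟨v, hvp⟩, by
      show ((fibreEquivPlacesOver X pp) ((fibreEquivPlacesOver X pp).symm ⟨v, hvp⟩)).1 = v
      rw [Equiv.apply_symm_apply]⟩
  -- positivity of the constants
  have hord : (0 : ℝ) < X.ordq v := by exact_mod_cast X.ordq_pos hv
  have hl : (0 : ℝ) < X.l := by exact_mod_cast X.l_prime.pos
  have hlogp : 0 < Real.log (pp : ℕ) := Real.log_pos (by exact_mod_cast (Fact.out : (pp : ℕ).Prime).one_lt)
  have he : (0 : ℝ) < ramIdx F v := by exact_mod_cast Nat.pos_of_ne_zero (ramIdx_ne_zero F v)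
  have hf : (0 : ℝ) < resDeg F v := by exact_mod_cast Nat.pos_of_ne_zero (resDeg_ne_zero F v)
  -- the right-hand side of (3.4) at `v ∈ S`, unfolded: `−(ord_v(q_v)/(2l)) · (f·log p) / (e·f)`
  have h1 : Real.log ‖(tq pp x : kOf X (pp : ℕ) x)‖ =
      -(X.qPilot v) * logNorm F v / localDegree F v := by
    have := htq pp x
    conv_rhs at this => rw [hx]
    exact this
  rw [X.qPilot_apply_of_mem hv, logNorm_eq, localDegree, hpp, Nat.cast_mul] at h1
  by_cases h0 : tq pp x = 0
  · -- `log ‖0‖ = 0`, but the right-hand side is negative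
    exfalso
    rw [h0, norm_zero, Real.log_zero] at h1
    have hneg : -((X.ordq v : ℝ) / (2 * X.l)) * (resDeg F v * Real.log (pp : ℕ)) / (ramIdx F v * resDeg F v) < 0 := by
      apply div_neg_of_neg_of_pos
      · have : 0 < (X.ordq v : ℝ) / (2 * X.l) * (resDeg F v * Real.log (pp : ℕ)) := by positivity
        linarith
      · positivity
    linarith
  · -- `tq ≠ 0`: its log-norm is `−(k/e)·log p` for an integer `k`, so `ord_v(q_v)/(2l) = k`
    obtain ⟨k, hk⟩ := exists_int_log_norm_kOf_eq X (pp : ℕ) x h0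
    conv_rhs at hk => rw [hx, ← ramIdx_eq]
    rw [hk] at h1
    -- clear denominators: `ord_v(q_v) = 2l·k`
    have hkey : (X.ordq v : ℝ) = 2 * X.l * k := by
      field_simp at h1
      nlinarith [h1, hlogp, he, hf, hl, mul_pos he hf, mul_pos (mul_pos he hf) hlogp]
    refine ⟨k, ?_⟩
    exact_mod_cast hkey

/-- **Characterisation of the realisability of the `q`-idele binder** (abc-iut-c312-3's existence direction p420764 +
the converse above): `q`-ideles over the completions `F_v` realising `P_q` in Dupuy–Hilado's normalisation (3.4),
non-zero everywhere, EXIST iff `2l ∣ ord_v(q_v)` at every `v ∈ S`. [cite: DupuyHilado2025, §3.3, §3.4] -/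
theorem exists_realising_qIdeles_iff :
    (∃ tq : ∀ (pp : Nat.Primes) (x : (thetaIndex X).Fibre (.inr pp)),
        haveI : Fact (pp : ℕ).Prime := ⟨pp.2⟩; kOf X pp.1 x,
      (∀ pp x, tq pp x ≠ 0) ∧
        ∀ (pp : Nat.Primes) (x : (thetaIndex X).Fibre (.inr pp)),
          haveI : Fact (pp : ℕ).Prime := ⟨pp.2⟩
          Real.log ‖tq pp x‖ = -(X.qPilot (placeOf X pp.1 x)) * logNorm F (placeOf X pp.1 x) /
            localDegree F (placeOf X pp.1 x)) ↔
      ∀ v ∈ X.S, (2 * X.l : ℤ) ∣ X.ordq v :=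
  ⟨fun ⟨tq, _, htq⟩ _ hv => two_mul_l_dvd_ordq_of_realising X tq htq hv, exists_realising_qIdeles X⟩

end Thm311.Real

namespace Cor312Prov

open Thm311.Real Literature.IUT.HodgeTheaters Literature.IUT.LogVolume Literature.NumberTheory.NumberFields

variable {F K Fbar : Type} [Field F] [NumberField F] [Field K] [NumberField K] [Algebra F K] [Field Fbar]
  [Algebra F Fbar] [Algebra K Fbar] {E : WeierstrassCurve F} [E.IsElliptic] {l : ℕ} {Pb : BadPlacePredicates K}
  {D : InitialThetaData F K Fbar E l Pb} {X : PilotData F}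

/-- **[IUTchI] Def. 3.1 (c) forbids `2l ∣ ord_v(q_v)` at the pilot data OF initial Θ-data.** For the Dupuy–Hilado pilot
datum `X` OF `D` (abc-iut-c312-8's `IsPilotDataOf D X`: same `l`, `S = 𝕍(F)^bad`, `ord_v(q_v) = ord_v(Δ_min)`), the
field `l_coprime_qParamOrd` of abc-iut-L5-t2's `InitialThetaData` — "`l` is prime … to the orders of the `q`-parameters of
`E_F` at the primes of `V(F)^bad`" ([IUTchI] Def. 3.1 (c), kurims p. 62) — gives `gcd(l, ord_v(q_v)) = 1`, hence, as
`l ≥ 5 > 1`, `l ∤ ord_v(q_v)` and a fortiori `2l ∤ ord_v(q_v)` at EVERY `v ∈ S`. [claim: Mochizuki2012, status: disputed]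
for the quoted clause; the arithmetic is elementary. -/
theorem not_two_mul_l_dvd_ordq_of_isPilotDataOf (h : IsPilotDataOf D X) {v : HeightOneSpectrum (𝓞 F)}
    (hv : v ∈ X.S) : ¬ (2 * X.l : ℤ) ∣ X.ordq v := by
  -- `v` as a finite place of `F`, in `𝕍(F)^bad`
  have hmem : (FinitePlace.mk v) ∈ D.VFbad := (h.mem_S_iff (FinitePlace.mk v)).mp (by
    rw [FinitePlace.maximalIdeal_mk]; exact hv)
  have hcop : l.Coprime (qParamOrd E v) := by
    have := D.l_coprime_qParamOrd (FinitePlace.mk v) hmem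
    rwa [FinitePlace.maximalIdeal_mk] at this
  have hord : X.ordq v = (qParamOrd E v : ℤ) := by
    have := h.ordq_eq (FinitePlace.mk v) hmem
    rwa [FinitePlace.maximalIdeal_mk] at this
  rintro ⟨m, hm⟩
  -- `l ∣ ord_v(q_v)` in `ℕ`
  have hdvd : l ∣ qParamOrd E v := by
    have h1 : (l : ℤ) ∣ (qParamOrd E v : ℤ) := ⟨2 * m, by rw [← hord, hm, h.l_eq]; ring⟩
    exact_mod_cast h1
  have hl1 : l = 1 := Nat.Coprime.eq_one_of_dvd hcop hdvd
  have h5 := D.five_le_l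
  omega

/-- **No `q`-ideles over the completions of `F` realise `P_q` at the pilot data OF initial Θ-data** — the `htq` binder of
the branch-C certificates at the genuine setting (`Conditional.Shrink2.cor312Of_of_S` p430322, `cor312Of_of_S_genuine` /
`cor312Of_of_SH_genuine` / `abc_of_S_v3` p430884, `abc_of_SH_shrink3`) is UNSATISFIABLE whenever `IsPilotDataOf D X` holds:
realising forces `2l ∣ ord_v(q_v)` on `S ≠ ∅` (`two_mul_l_dvd_ordq_of_realising`), Def. 3.1 (c) forbids it
(`not_two_mul_l_dvd_ordq_of_isPilotDataOf`). ROOT CAUSE (the «recorded seam» of `AbcOfSShrink2.lean`, now a kernel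
CONTRADICTION rather than a «restriction on D»): print realises the `q`-pilot `q̲_v = q_v^{1/2l}` in `K_v̲`, `K = F(E_F[l])`
([IUTchI] Ex. 3.2 (iv), kurims p. 71), never in `F_v`; the tree's print-normalised setting reads the pilot regions off
ideles of `F` = the field of `X` = the field of `D`. [cite: Mochizuki2012, IUTchI Ex. 3.2 (iv) p. 71]
[cite: DupuyHilado2025, §3.3, §3.4] -/
theorem false_of_isPilotDataOf_of_realising (h : IsPilotDataOf D X)
    (tq : ∀ (pp : Nat.Primes) (x : (thetaIndex X).Fibre (.inr pp)), haveI : Fact (pp : ℕ).Prime := ⟨pp.2⟩; kOf X pp.1 x)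
    (htq : ∀ (pp : Nat.Primes) (x : (thetaIndex X).Fibre (.inr pp)),
      haveI : Fact (pp : ℕ).Prime := ⟨pp.2⟩
      Real.log ‖tq pp x‖ = -(X.qPilot (placeOf X pp.1 x)) * logNorm F (placeOf X pp.1 x) /
        localDegree F (placeOf X pp.1 x)) : False := by
  obtain ⟨v, hv⟩ := X.S_nonempty
  exact not_two_mul_l_dvd_ordq_of_isPilotDataOf h hv (two_mul_l_dvd_ordq_of_realising X tq htq hv)

/-- Existential form: at the pilot data OF initial Θ-data there is NO family of `q`-ideles over the `F_v` realising `P_q`.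
[cite: DupuyHilado2025, §3.4] -/
theorem not_exists_realising_qIdeles_of_isPilotDataOf (h : IsPilotDataOf D X) :
    ¬ ∃ tq : ∀ (pp : Nat.Primes) (x : (thetaIndex X).Fibre (.inr pp)), haveI : Fact (pp : ℕ).Prime := ⟨pp.2⟩; kOf X pp.1 x,
        ∀ (pp : Nat.Primes) (x : (thetaIndex X).Fibre (.inr pp)),
          haveI : Fact (pp : ℕ).Prime := ⟨pp.2⟩
          Real.log ‖tq pp x‖ = -(X.qPilot (placeOf X pp.1 x)) * logNorm F (placeOf X pp.1 x) /
            localDegree F (placeOf X pp.1 x) :=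
  fun ⟨tq, htq⟩ => false_of_isPilotDataOf_of_realising h tq htq

/-- The hypothesis `hdiv : ∀ v ∈ S, 2l ∣ ord_v(q_v)` of abc-iut-c312-7's non-vacuity theorem
`Thm311.Real.exists_ideles_settingPrVolSharp` (and of c312-3's `exists_realising_qIdeles/_thetaIdeles`) FAILS at every
pilot datum OF initial Θ-data: those witnesses inhabit the idele binders for SYNTHETIC pilot data only, never for the
`X` of a `D`. [cite: DupuyHilado2025, §3.3] -/
theorem not_hdiv_of_isPilotDataOf (h : IsPilotDataOf D X) : ¬ ∀ v ∈ X.S, (2 * X.l : ℤ) ∣ X.ordq v := by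
  obtain ⟨v, hv⟩ := X.S_nonempty
  exact fun hdiv => not_two_mul_l_dvd_ordq_of_isPilotDataOf h hv (hdiv v hv)

end Cor312Prov

namespace Conditional

open Thm311 Thm311.Real Cor312 Cor312Vol Cor312Prov
open Literature.IUT.LogThetaLattice Literature.IUT.LogVolume Literature.IUT.HodgeTheaters
open Literature.NumberTheory.DiophantineGeometry.GenEll NumberField IsDedekindDomain

/-- **Admissible `λ`-line data EXIST and carry a genuine Θ-volume datum** (composition of two tree theorems, recorded for
the refutations below): abc-iut's `Cor22.exists_thm110Legendre_antecedent` (a rational `λ` in `K_V = CBData.std {2}` with a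
prime `l ≥ 7` meeting `AdmitsCore`, (P2), (P5), (P6)) and the PROVED child (i) `ThetaPartII.stub_thetaData` (such `(P, l)`
carry a `Cor22.ThetaVolumeDatumAt P l`). [cite: Mochizuki2012, IUTchIV Cor 2.2 (ii) proof p.46] -/
theorem exists_admissible_thetaVolumeDatum :
    ∃ (P : NFPoint) (l : ℕ), P ∈ UP ∧ l.Prime ∧ 5 ≤ l ∧ Cor22.AdmitsCore P ∧ Cor22.CondP2 P l ∧ Cor22.CondP5 P l ∧
      Cor22.CondP6 P l ∧ Nonempty (Cor22.ThetaVolumeDatumAt P l) := by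
  obtain ⟨-, P, l, -, hUP, -, -, hl, h7, hcore, h2, h5, h6, -⟩ := Cor22.exists_thm110Legendre_antecedent 0
  have h5l : 5 ≤ l := le_trans (by norm_num) h7
  exact ⟨P, l, hUP, hl, h5l, hcore, h2, h5, h6,
    Summit.ABC.ABC.Theorems.ThetaPartII.stub_thetaData P hUP l hl h5l hcore h2 h5 h6⟩

/-- **The hypothesis `H` of the branch-C certificate OF RECORD `abc_of_S_v3` (abc-iut-C-cert-2, p430884) is FALSE.**
`H` asks, at EVERY admissible `(P₀, l)` and EVERY genuine Θ-volume datum `T`, for pilot data `X` OF `T.D`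
(`IsPilotDataOf T.D X`) together with `q`-ideles over the completions of `T.F` REALISING `P_q`; by
`Cor312Prov.false_of_isPilotDataOf_of_realising` no such pair exists, and by `exists_admissible_thetaVolumeDatum` there IS an
admissible datum to instantiate `H` at. CONSEQUENCE: `abc_of_S_v3 : H → hvol → ABC` is VACUOUS (a false antecedent); its
scoreboard «explicit 2 / EFFECTIVE 2» counts a contradictory bundle. This refutes NEITHER S/S_H NOR any reading of [IUTchIII]
Cor. 3.12: it is the idele normalisation of the assembled setting (q-pilot `q_v^{1/2l}` read in `F_v` instead of print's
`K_v̲`, [IUTchI] Ex. 3.2 (iv)) colliding with Def. 3.1 (c) as typed. REPAIR (owners c312-7/c312-8/C-cert): realise the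
INTEGRAL divisor `𝔮 = 2l·P_q` (ideles `q_v ∈ F_v`) and carry `1/(2l)` in the volume normalisation, or read the pilot ideles in the
completions `K_v̲`, `v̲ ∈ V̲` (Def. 3.1 (e)). [cite: Mochizuki2012, IUTchI Ex. 3.2 (iv) p. 71] [claim: Mochizuki2012, status: disputed] -/
theorem abc_of_S_v3_hypothesis_false
    (H : ∀ P₀ : NFPoint, P₀ ∈ UP → ∀ l : ℕ, l.Prime → 5 ≤ l →
      Cor22.AdmitsCore P₀ → Cor22.CondP2 P₀ l → Cor22.CondP5 P₀ l → Cor22.CondP6 P₀ l →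
      ∀ T : Cor22.ThetaVolumeDatumAt P₀ l,
        letI := T.instFieldF; letI := T.instNumberFieldF; letI := T.instFieldK; letI := T.instNumberFieldK
        letI := T.instAlgebraK; letI := T.instFieldFbar; letI := T.instAlgebraFbar; letI := T.instAlgebraKFbar
        letI := T.instIsElliptic
        ∃ (X : PilotData T.F) (M : Type) (_ : Field M) (_ : NumberField M)
          (archPk : ∀ (j : (thetaIndex X).Label) (vQ : (thetaIndex X).VQ), Set ((logShellsDH X (analyticLogv T.F)).Packet j vQ))
          (archSub : ∀ (j : (thetaIndex X).Label) (v : (thetaIndex X).V),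
            Set ((logShellsDH X (analyticLogv T.F)).Packet j ((thetaIndex X).over v)))
          (Ψ : ℤ → ∀ v : (thetaIndex X).V, v ∈ (thetaIndex X).Vbad → Set ((logShellsDH X (analyticLogv T.F)).StarPacket v))
          (act : ℤ → ∀ v : (thetaIndex X).V, v ∈ (thetaIndex X).Vbad →
            (logShellsDH X (analyticLogv T.F)).StarPacket v → Module.End ℚ ((logShellsDH X (analyticLogv T.F)).StarPacket v))
          (Mmod : ℤ → ∀ j : (thetaIndex X).LabelStar, Set ((logShellsDH X (analyticLogv T.F)).GlobalPacket j.1))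
          (region : ℤ → ∀ j : (thetaIndex X).LabelStar, FinDivisor M → ∀ vQ : (thetaIndex X).VQ,
            Set ((logShellsDH X (analyticLogv T.F)).Packet j.1 vQ))
          (frobAdm : ℤ → ℤ → ∀ (j : (thetaIndex X).Label) (vQ : (thetaIndex X).VQ),
            Set ((logShellsDH X (analyticLogv T.F)).Packet j vQ) → Prop)
          (frobLogvol : ℤ → ℤ → ∀ (j : (thetaIndex X).Label) (vQ : (thetaIndex X).VQ),
            Set ((logShellsDH X (analyticLogv T.F)).Packet j vQ) → ℝ)
          (frobΨ : ℤ → ℤ → ∀ v : (thetaIndex X).V, v ∈ (thetaIndex X).Vbad →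
            Set ((logShellsDH X (analyticLogv T.F)).StarPacket v))
          (frobMmod : ℤ → ℤ → ∀ j : (thetaIndex X).LabelStar, Set ((logShellsDH X (analyticLogv T.F)).GlobalPacket j.1))
          (unitImage : ℤ → ℤ → ℕ → ∀ (j : (thetaIndex X).Label) (vQ : (thetaIndex X).VQ),
            Set ((logShellsDH X (analyticLogv T.F)).Packet j vQ))
          (ballImage : ℤ → ℤ → ∀ (j : (thetaIndex X).Label) (vQ : (thetaIndex X).VQ),
            Set ((logShellsDH X (analyticLogv T.F)).Packet j vQ))
          (thetaDiv : ℤ → ℤ → LgpDivisor M (thetaIndex X).lstar)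
          (n : ℤ) (HT : Type) (LogLink : HT → HT → Type) (IsFull : ∀ {s t : HT}, LogLink s t → Prop)
          (lat : LGPGaussianLogThetaLattice LogLink IsFull)
          (Frd : Type) (IsoF : Frd → Frd → Type) (Ob : Frd → Type) (realify : Frd → Frd) (Strip : Type)
          (IsoS : Strip → Strip → Type) (Mv : ∀ v : (thetaIndex X).V, v ∈ (thetaIndex X).Vbad → Type)
          (_ : ∀ v h, Monoid (Mv v h))
          (sig : GlobalLGPFrobenioidSignature (thetaIndex X).lstar (thetaIndex X).V (· ∈ (thetaIndex X).Vbad)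
            Frd IsoF Ob realify Strip IsoS Mv)
          (split : SplittingMonoids Mv) (ObΔ : Type) (N : ∀ v : (thetaIndex X).V, v ∈ (thetaIndex X).Vbad → Type)
          (_ : ∀ v h, Monoid (N v h)) (qData : QPilotData ObΔ N)
          (tq : ∀ (pp : Nat.Primes) (x : (thetaIndex X).Fibre (.inr pp)), haveI : Fact (pp : ℕ).Prime := ⟨pp.2⟩; kOf X pp.1 x)
          (t : ∀ (pp : Nat.Primes) (_ : Fin X.lstar) (x : (thetaIndex X).Fibre (.inr pp)),
            haveI : Fact (pp : ℕ).Prime := ⟨pp.2⟩; kOf X pp.1 x)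
          (ρ : (∀ v : (thetaIndex X).V, v ∈ (thetaIndex X).Vbad → Set ((logShellsDH X (analyticLogv T.F)).StarPacket v)) →
            ∀ (j : (thetaIndex X).Label) (vQ : (thetaIndex X).VQ), Set ((logShellsDH X (analyticLogv T.F)).Packet j vQ))
          (qK : ∀ v : (thetaIndex X).V, v ∈ (thetaIndex X).Vbad → Set ((logShellsDH X (analyticLogv T.F)).StarPacket v))
          (htq0 : ∀ pp x, tq pp x ≠ 0)
          (htq1 : ∀ (pp : Nat.Primes) (x : (thetaIndex X).Fibre (.inr pp)),
            haveI : Fact (pp : ℕ).Prime := ⟨pp.2⟩; placeOf X pp.1 x ∉ X.S → ‖tq pp x‖ = 1)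
          (_ : ∀ (pp : Nat.Primes) (x : (thetaIndex X).Fibre (.inr pp)),
            haveI : Fact (pp : ℕ).Prime := ⟨pp.2⟩
            Real.log ‖tq pp x‖ = -(X.qPilot (placeOf X pp.1 x)) * logNorm T.F (placeOf X pp.1 x) /
              localDegree T.F (placeOf X pp.1 x))
          (_ : ∀ pp i x, t pp i x ≠ 0)
          (_ : ∀ (pp : Nat.Primes) (i : Fin X.lstar) (x : (thetaIndex X).Fibre (.inr pp)),
            haveI : Fact (pp : ℕ).Prime := ⟨pp.2⟩; placeOf X pp.1 x ∉ X.S → ‖t pp i x‖ = 1)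
          (_ : IsPilotDataOf T.D X)
          (_ : ∃ e : (thetaIndex X).V ≃ T.D.V, ∀ v : (thetaIndex X).V,
            v ∈ (thetaIndex X).Vbad ↔ ((e v : T.D.V) : Val T.K) ∈ T.D.Vbad),
          Cor312Vol.PilotKummerCompatHull
              (LatticeSituation.ofShells (logShellsDH X (analyticLogv T.F)) M archPk archSub
                (summandPiecesPr X (logvAnalytic_analyticLogv (F := T.F))).Adm
                (summandPiecesPr X (logvAnalytic_analyticLogv (F := T.F))).logvol Ψ act Mmod region
                frobAdm frobLogvol frobΨ frobMmod unitImage ballImage thetaDiv)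
              (settingPrVolSharp X (logvAnalytic_analyticLogv (F := T.F)) M archPk archSub Ψ act Mmod region n lat sig split
                qData tq t htq0 htq1) ρ qK ∧
            Cor312Vol.QPinned
              (LatticeSituation.ofShells (logShellsDH X (analyticLogv T.F)) M archPk archSub
                (summandPiecesPr X (logvAnalytic_analyticLogv (F := T.F))).Adm
                (summandPiecesPr X (logvAnalytic_analyticLogv (F := T.F))).logvol Ψ act Mmod region
                frobAdm frobLogvol frobΨ frobMmod unitImage ballImage thetaDiv)
              (settingPrVolSharp X (logvAnalytic_analyticLogv (F := T.F)) M archPk archSub Ψ act Mmod region n lat sig split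
                qData tq t htq0 htq1) ρ qK ∧
            (settingPrVolSharp X (logvAnalytic_analyticLogv (F := T.F)) M archPk archSub Ψ act Mmod region n lat sig split qData
                tq t htq0 htq1).negLogTheta ≤ ((T.negLogTheta : ℝ) : WithTop ℝ)) :
    False := by
  obtain ⟨P₀, l, hP, hl, h5, hc, h2, h5', h6, ⟨T⟩⟩ := exists_admissible_thetaVolumeDatum
  letI := T.instFieldF; letI := T.instNumberFieldF; letI := T.instFieldK; letI := T.instNumberFieldK
  letI := T.instAlgebraK; letI := T.instFieldFbar; letI := T.instAlgebraFbar; letI := T.instAlgebraKFbar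
  letI := T.instIsElliptic
  obtain ⟨X, M, _, _, archPk, archSub, Ψ, act, Mmod, region, frobAdm, frobLogvol, frobΨ, frobMmod, unitImage, ballImage,
    thetaDiv, n, HT, LogLink, IsFull, lat, Frd, IsoF, Ob, realify, Strip, IsoS, Mv, _, sig, split, ObΔ, N, _, qData, tq, t, ρ, qK,
    htq0, htq1, htq, ht0, ht1, hX, hplaces, hSH, hQPin, hΘ⟩ := H P₀ hP l hl h5 hc h2 h5' h6 T
  exact Cor312Prov.false_of_isPilotDataOf_of_realising hX tq htq

/-- **The side conditions `hX ∧ htq` of `abc_of_S_shrink2` (abc-iut-C-cert-3, p430322) are jointly UNSATISFIABLE** (the same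
collision, in Shrink2's unbundled binder shape: pilot data `X P l T` OF `T.D` for all data, and q-ideles over `T.F` realising
`P_q` for all data — instantiate at one admissible datum). Hence `abc_of_S_shrink2` is VACUOUS as well, and its movement
«READ 2 → 1 (`hq` DISCHARGED)» on the C scoreboard is a discharge under a contradictory side condition; the same holds verbatim
for `abc_of_SH_shrink3` (same `hX`, `htq` binders). [claim: Mochizuki2012, status: disputed] -/
theorem abc_of_S_shrink2_side_conditions_false
    (X : ∀ (P : NFPoint) (l : ℕ) (T : Cor22.ThetaVolumeDatumAt P l), @PilotData T.F T.instFieldF T.instNumberFieldF)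
    (tq : ∀ (P : NFPoint) (l : ℕ) (T : Cor22.ThetaVolumeDatumAt P l), letI := T.instFieldF; letI := T.instNumberFieldF;
      ∀ (pp : Nat.Primes) (x : (thetaIndex (X P l T)).Fibre (.inr pp)), haveI : Fact (pp : ℕ).Prime := ⟨pp.2⟩; kOf (X P l T) pp.1 x)
    (hX : ∀ (P : NFPoint) (l : ℕ) (T : Cor22.ThetaVolumeDatumAt P l), letI := T.instFieldF; letI := T.instNumberFieldF; letI := T.instAlgebraF; letI := T.instFieldK;
        letI := T.instNumberFieldK; letI := T.instAlgebraK; letI := T.instFieldFbar; letI := T.instAlgebraFbar;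
        letI := T.instAlgebraKFbar; letI := T.instIsElliptic;
      Cor312Prov.IsPilotDataOf T.D (X P l T))
    (htq : ∀ (P : NFPoint) (l : ℕ) (T : Cor22.ThetaVolumeDatumAt P l), letI := T.instFieldF; letI := T.instNumberFieldF;
      ∀ (pp : Nat.Primes) (x : (thetaIndex (X P l T)).Fibre (.inr pp)),
        haveI : Fact (pp : ℕ).Prime := ⟨pp.2⟩
        Real.log ‖tq P l T pp x‖ = -((X P l T).qPilot (placeOf (X P l T) pp.1 x)) * logNorm T.F (placeOf (X P l T) pp.1 x) /
          localDegree T.F (placeOf (X P l T) pp.1 x)) :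
    False := by
  obtain ⟨P₀, l, -, -, -, -, -, -, -, ⟨T⟩⟩ := exists_admissible_thetaVolumeDatum
  letI := T.instFieldF; letI := T.instNumberFieldF; letI := T.instFieldK; letI := T.instNumberFieldK
  letI := T.instAlgebraK; letI := T.instFieldFbar; letI := T.instAlgebraFbar; letI := T.instAlgebraKFbar
  letI := T.instIsElliptic
  exact Cor312Prov.false_of_isPilotDataOf_of_realising (hX P₀ l T) (tq P₀ l T) (htq P₀ l T)

/-- **Per-datum vacuity, stark form.** At the pilot data OF initial Θ-data, `hX` and `htq` ALONE already «prove» the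
Cor.-3.12 inequality `I.Cor312Of` for EVERY volume input `I` — with no S, no S_H, no pin, no Θ-reading, no Thm. 3.11 —
because they are contradictory. So in `Shrink2.cor312Of_of_S`, `cor312Of_of_S_genuine`, `cor312Of_of_SH_genuine`,
`Shrink3.cor312Of_of_SH` every OTHER binder is idle in the presence of `hX ∧ htq`. Nothing about Cor. 3.12 follows.
[claim: Mochizuki2012, status: disputed] -/
theorem cor312Of_of_isPilotDataOf_of_realising
    {F K Fbar : Type} [Field F] [NumberField F] [Field K] [NumberField K] [Algebra F K] [Field Fbar] [Algebra F Fbar]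
    [Algebra K Fbar] {E : WeierstrassCurve F} [E.IsElliptic] {l : ℕ} {Pb : BadPlacePredicates K}
    {D : InitialThetaData F K Fbar E l Pb} {X : PilotData F} (hX : Cor312Prov.IsPilotDataOf D X)
    (tq : ∀ (pp : Nat.Primes) (x : (thetaIndex X).Fibre (.inr pp)), haveI : Fact (pp : ℕ).Prime := ⟨pp.2⟩; kOf X pp.1 x)
    (htq : ∀ (pp : Nat.Primes) (x : (thetaIndex X).Fibre (.inr pp)),
      haveI : Fact (pp : ℕ).Prime := ⟨pp.2⟩
      Real.log ‖tq pp x‖ = -(X.qPilot (placeOf X pp.1 x)) * logNorm F (placeOf X pp.1 x) /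
        localDegree F (placeOf X pp.1 x))
    (I : ThetaVolumeInput (fieldOfModuli E) K) : I.Cor312Of :=
  (Cor312Prov.false_of_isPilotDataOf_of_realising hX tq htq).elim

end Conditional

end Summit.ABC.IUTFork

end
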